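import Literature.Probability.RandomPlanarGeometry.SLEKappaRhoOneStep
import Literature.Probability.RandomPlanarGeometry.SLEKappaRhoLogGammaJets
import Literature.Probability.RandomPlanarGeometry.SLEKappaRhoTranslates
import Literature.Probability.RandomPlanarGeometry.SLEKappaRhoSlidArc
import HarnessLib

/-!
# [LSW] Lemma 8.9, the one-step expansion of `M`: absorbed error and the real form with `oneSidedM`

G. F. Lawler, O. Schramm, W. Werner, *Conformal restriction: the chordal case*, J. Amer. Math.
Soc. **16** (2003) 917–955 (**[LSW]**), §8.4, Lemma 8.9 and its proof.

Sequel of `SLEKappaRhoOneStep` (`norm_exp_oneStep_sub_le`: the raw one-step expansion of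
`exp(ell)`). Here:

* the raw error `rawErr B_L B_Q B_e` is absorbed into
  `K · (u η_s + u² + |x|³ + a² + |a||x| + u|a| + u|x|)` with `K` depending only on the constants
  of the controlled class (`rawErr_absorb`, pure real algebra; `stepErrAll_le` removes the
  dependence on `d = Φ'_B(0) ∈ [d_min, 1]`);
* `exp (ell (starMap B) ρ 0 o) = oneSidedM ρ B o` for a `+`-hull and `o ≤ 0`
  (`IsPlusHull.exp_ell_zero_eq`), so that the expansion is an expansion of [LSW]'s `M`;
* the jets at the diagonal `o = 0` and `(ρ ∂ₓ − 2 ∂_y) ell (0, 0) = 0`;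
* the packaged one step `oneSidedM_slidHull_expansion` consumed by the conditional-increment
  proof of Lemma 8.9, together with the companion facts on the jets (bounds, the drift identity
  in the multiplied form `ρℓ₁ − 2m₁ + Z(λ + (4/3)(ℓ₂ + ℓ₁²)) = 0`, `|ρℓ₁ − 2m₁| ≤ C Z`).

No named facts; definitions are explicit constants.

## References

* [LSW] §8.4, Lemma 8.9 and its proof; §5 (5.1). [LawlerSchrammWerner2003Restriction]
-/

noncomputable section

open Set Filter Metric Complex
open scoped Topology Real NNReal
open UpperHalfPlane (upperHalfPlaneSet)

namespace Literature.Probability.RandomPlanarGeometry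

namespace SLEKappaRho

open Loewner Literature.Analysis.Complex

/-! ### The error of the jets is linear in `(η_s, u)`, uniformly for `d ∈ [d_min, 1]` -/

variable {d dmin δ η ρ₀ m₀ r₁ : ℝ}

/-- `farCrude` is monotone in `d ≤ 1`. [folklore] -/
theorem farCrude_mono (hd : d ≤ 1) (hm₀ : 0 < m₀) (hρ₀ : 0 < ρ₀) : farCrude d ρ₀ m₀ ≤ farCrude 1 ρ₀ m₀ := by
  unfold farCrude; gcongr

/-- `farC₁` is monotone in `d ≤ 1`. [folklore] -/
theorem farC₁_mono (hd : d ≤ 1) (hm₀ : 0 < m₀) : farC₁ d ρ₀ m₀ ≤ farC₁ 1 ρ₀ m₀ := by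
  unfold farC₁; gcongr

/-- `farC₂` is monotone in `d ≤ 1`. [folklore] -/
theorem farC₂_mono (hd : d ≤ 1) (hm₀ : 0 < m₀) (hρ₀ : 0 < ρ₀) (hr₁ : 0 < r₁) :
    farC₂ d ρ₀ m₀ r₁ ≤ farC₂ 1 ρ₀ m₀ r₁ := by
  unfold farC₂
  have := farCrude_mono hd hm₀ hρ₀ (ρ₀ := ρ₀)
  gcongr

/-- `0 ≤ farCrude`. [folklore] -/
theorem farCrude_nonneg (hd : 0 ≤ d) (hm₀ : 0 < m₀) (hρ₀ : 0 < ρ₀) : 0 ≤ farCrude d ρ₀ m₀ := by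
  unfold farCrude; positivity

/-- `0 ≤ farC₁`. [folklore] -/
theorem farC₁_nonneg (hd : 0 ≤ d) (hm₀ : 0 < m₀) (hρ₀ : 0 < ρ₀) : 0 ≤ farC₁ d ρ₀ m₀ := by
  unfold farC₁; positivity

/-- `0 ≤ farC₂`. [folklore] -/
theorem farC₂_nonneg (hd : 0 ≤ d) (hm₀ : 0 < m₀) (hρ₀ : 0 < ρ₀) (hr₁ : 0 < r₁) : 0 ≤ farC₂ d ρ₀ m₀ r₁ := by
  unfold farC₂; have := farCrude_nonneg hd hm₀ hρ₀; positivity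

/-- The `η_s`-coefficient of the bound `u (errP η_s + errQ u)` for `stepErrAll`, for `d ≥ d_min`.
[folklore] -/
def errP (dmin δ η ρ₀ : ℝ) : ℝ :=
  825000 / (dmin * ρ₀ ^ 3) + (2 / farRadius ρ₀ η + 9 / ρ₀) * farC₁ 1 ρ₀ (δ * ρ₀ / 16)

/-- The `u`-coefficient. [folklore] -/
def errQ (dmin δ η ρ₀ : ℝ) : ℝ :=
  825000 / (dmin * ρ₀ ^ 4) + (2 / farRadius ρ₀ η + 9 / ρ₀) * farC₂ 1 ρ₀ (δ * ρ₀ / 16) (farRadius ρ₀ η)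

/-- `0 ≤ errP`. [folklore] -/
theorem errP_nonneg (hdmin : 0 < dmin) (hδ : 0 < δ) (hη : 0 < η) (hρ₀ : 0 < ρ₀) : 0 ≤ errP dmin δ η ρ₀ := by
  unfold errP
  have := farRadius_pos hρ₀ hη
  have := farC₁_nonneg zero_le_one (by positivity : 0 < δ * ρ₀ / 16) hρ₀
  positivity

/-- `0 ≤ errQ`. [folklore] -/
theorem errQ_nonneg (hdmin : 0 < dmin) (hδ : 0 < δ) (hη : 0 < η) (hρ₀ : 0 < ρ₀) : 0 ≤ errQ dmin δ η ρ₀ := by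
  unfold errQ
  have hr := farRadius_pos hρ₀ hη
  have := farC₂_nonneg zero_le_one (by positivity : 0 < δ * ρ₀ / 16) hρ₀ hr
  positivity

/-- **`stepErrAll ≤ u (errP η_s + errQ u)`** for `d_min ≤ d ≤ 1`. [folklore] -/
theorem stepErrAll_le (hdmin : 0 < dmin) (hd : dmin ≤ d) (hd1 : d ≤ 1) (hδ : 0 < δ) (hη : 0 < η) (hρ₀ : 0 < ρ₀)
    {ηs u : ℝ} (hηs : 0 ≤ ηs) (hu : 0 ≤ u) :
    stepErrAll d δ η ρ₀ ηs u ≤ u * (errP dmin δ η ρ₀ * ηs + errQ dmin δ η ρ₀ * u) := by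
  have hr := farRadius_pos hρ₀ hη
  have hm₀ : 0 < δ * ρ₀ / 16 := by positivity
  have hd0 : 0 < d := hdmin.trans_le hd
  have hF₁ := farC₁_mono (ρ₀ := ρ₀) hd1 hm₀
  have hF₂ := farC₂_mono hd1 hm₀ hρ₀ hr
  have hF₁0 := farC₁_nonneg hd0.le hm₀ hρ₀
  have hF₂0 := farC₂_nonneg hd0.le hm₀ hρ₀ hr
  set F₁ := farC₁ d ρ₀ (δ * ρ₀ / 16)
  set F₂ := farC₂ d ρ₀ (δ * ρ₀ / 16) (farRadius ρ₀ η)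
  set G₁ := farC₁ 1 ρ₀ (δ * ρ₀ / 16)
  set G₂ := farC₂ 1 ρ₀ (δ * ρ₀ / 16) (farRadius ρ₀ η)
  set r := farRadius ρ₀ η
  -- the pieces
  have h1 : 3 * stepErr₁ d ρ₀ ηs u ≤ u * (600000 / (dmin * ρ₀ ^ 3) * ηs + 600000 / (dmin * ρ₀ ^ 4) * u) := by
    have e : 3 * stepErr₁ d ρ₀ ηs u = u * (600000 / (d * ρ₀ ^ 3) * ηs + 600000 / (d * ρ₀ ^ 4) * u) := by
      unfold stepErr₁; field_simp; ring
    rw [e]; gcongr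
  have h2 : 2 * (u * (F₁ * ηs + F₂ * u)) / r ≤ u * (2 / r * G₁ * ηs + 2 / r * G₂ * u) := by
    have e : 2 * (u * (F₁ * ηs + F₂ * u)) / r = u * (2 / r * F₁ * ηs + 2 / r * F₂ * u) := by
      field_simp
    rw [e]; gcongr
  have h3 : 9 * (25000 * u * (ηs * ρ₀ + u) / (d * ρ₀ ^ 3) + u * (F₁ * ηs + F₂ * u)) / ρ₀ ≤
      u * ((225000 / (dmin * ρ₀ ^ 3) + 9 / ρ₀ * G₁) * ηs + (225000 / (dmin * ρ₀ ^ 4) + 9 / ρ₀ * G₂) * u) := by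
    have e : 9 * (25000 * u * (ηs * ρ₀ + u) / (d * ρ₀ ^ 3) + u * (F₁ * ηs + F₂ * u)) / ρ₀ =
        u * ((225000 / (d * ρ₀ ^ 3) + 9 / ρ₀ * F₁) * ηs + (225000 / (d * ρ₀ ^ 4) + 9 / ρ₀ * F₂) * u) := by
      field_simp; ring
    rw [e]; gcongr
  have e : u * (errP dmin δ η ρ₀ * ηs + errQ dmin δ η ρ₀ * u) =
      u * (600000 / (dmin * ρ₀ ^ 3) * ηs + 600000 / (dmin * ρ₀ ^ 4) * u) +
      u * (2 / r * G₁ * ηs + 2 / r * G₂ * u) +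
      u * ((225000 / (dmin * ρ₀ ^ 3) + 9 / ρ₀ * G₁) * ηs + (225000 / (dmin * ρ₀ ^ 4) + 9 / ρ₀ * G₂) * u) := by
    unfold errP errQ; ring
  rw [e, stepErrAll]
  exact add_le_add (add_le_add h1 h2) h3

/-! ### Absorption of the raw error (pure real algebra) -/

/-- The absorbed error functional `W = uη_s + u² + |x|³ + a² + |a||x| + u|a| + u|x|`. [folklore] -/
def absorbW (X A u ηs : ℝ) : ℝ := u * ηs + u ^ 2 + X ^ 3 + A ^ 2 + A * X + u * A + u * X

/-- `0 ≤ absorbW` on nonnegative arguments. [folklore] -/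
theorem absorbW_nonneg {X A u ηs : ℝ} (hX : 0 ≤ X) (hA : 0 ≤ A) (hu : 0 ≤ u) (hηs : 0 ≤ ηs) :
    0 ≤ absorbW X A u ηs := by unfold absorbW; positivity

/-- The monomials of the expansion are `≤ W` (for `|x|, |a|, u, η_s ∈ [0, 1]`). [folklore] -/
theorem monomials_le_absorbW {X A u ηs : ℝ} (hX : 0 ≤ X) (hX1 : X ≤ 1) (hA : 0 ≤ A) (hA1 : A ≤ 1)
    (hu : 0 ≤ u) (hu1 : u ≤ 1) (hηs : 0 ≤ ηs) (hηs1 : ηs ≤ 1) :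
    u * ηs ≤ absorbW X A u ηs ∧ u ^ 2 ≤ absorbW X A u ηs ∧ X ^ 3 ≤ absorbW X A u ηs ∧
      A ^ 2 ≤ absorbW X A u ηs ∧ A * X ≤ absorbW X A u ηs ∧ u * A ≤ absorbW X A u ηs ∧
      u * X ≤ absorbW X A u ηs ∧ X ^ 4 ≤ absorbW X A u ηs ∧ X ^ 2 * A ≤ absorbW X A u ηs ∧
      A ^ 3 ≤ absorbW X A u ηs ∧ u ^ 3 ≤ absorbW X A u ηs ∧
      absorbW X A u ηs ≤ 4 * (X + A + u) ∧ absorbW X A u ηs ≤ 7 ∧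
      (X + A + u) ^ 3 ≤ 9 * absorbW X A u ηs := by
  have p1 : 0 ≤ u * ηs := mul_nonneg hu hηs
  have p2 : 0 ≤ u ^ 2 := pow_nonneg hu 2
  have p3 : 0 ≤ X ^ 3 := pow_nonneg hX 3
  have p4 : 0 ≤ A ^ 2 := pow_nonneg hA 2
  have p5 : 0 ≤ A * X := mul_nonneg hA hX
  have p6 : 0 ≤ u * A := mul_nonneg hu hA
  have p7 : 0 ≤ u * X := mul_nonneg hu hX
  have hX2 : X ^ 2 ≤ X := by nlinarith
  have hX4 : X ^ 4 ≤ X ^ 3 := by nlinarith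
  have hA3 : A ^ 3 ≤ A ^ 2 := by nlinarith
  have hu3 : u ^ 3 ≤ u ^ 2 := by nlinarith
  have hX2A : X ^ 2 * A ≤ A * X := by nlinarith
  have e1 : u * ηs ≤ u := mul_le_of_le_one_right hu hηs1
  have e2 : u ^ 2 ≤ u := by nlinarith
  have e3 : X ^ 3 ≤ X := by nlinarith
  have e4 : A ^ 2 ≤ A := by nlinarith
  have e5 : A * X ≤ A := mul_le_of_le_one_right hA hX1
  have e6 : u * A ≤ u := mul_le_of_le_one_right hu hA1
  have e7 : u * X ≤ u := mul_le_of_le_one_right hu hX1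
  have hT3 : (X + A + u) ^ 3 ≤ 9 * (X ^ 3 + A ^ 3 + u ^ 3) := by
    nlinarith [sq_nonneg (X - A), sq_nonneg (X - u), sq_nonneg (A - u), mul_nonneg hX hA, mul_nonneg hX hu,
      mul_nonneg hA hu, mul_nonneg (mul_nonneg hX hA) hu, sq_nonneg (X + A + u)]
  unfold absorbW
  refine ⟨by linarith, by linarith, by linarith, by linarith, by linarith, by linarith, by linarith, by linarith,
    by linarith, by linarith, by linarith, by linarith, by linarith, by nlinarith⟩

/-- The coefficient `C₂` of the absorbed bound of `B_e`. [folklore] -/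
def absorbC₂ (Me Λ k δ η Mg P Q : ℝ) : ℝ :=
  6 * k * (16 * Mg / η + P + Q) ^ 2 / δ ^ 2 + (k * P / δ + k * Q / δ) + 16 * Λ / η + Me * (32 / η ^ 3 + 16 / η ^ 2)

/-- The coefficient `C₁` of the linear bound `B_L + B_Q + B_e ≤ C₁ (|x| + |a| + u)`. [folklore] -/
def absorbC₁ (Me Λ k δ η Mg P Q : ℝ) : ℝ :=
  2 * Me / η + (2 * Me / η + 4 * Me / η ^ 2 + Λ) + 4 * absorbC₂ Me Λ k δ η Mg P Q

/-- **The absorbed one-step constant** `K`: `rawErr ≤ K · W`. [folklore] -/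
def absorbK (Me Λ k δ η Mg P Q : ℝ) : ℝ :=
  9 * absorbC₁ Me Λ k δ η Mg P Q ^ 3 + absorbC₂ Me Λ k δ η Mg P Q +
    ((2 * Me / η) ^ 2 + 2 * Me / η * (4 * Me / η ^ 2) + 2 * Me / η * Λ + 2 * Me / η * absorbC₂ Me Λ k δ η Mg P Q +
      3 * ((2 * Me / η) ^ 2 + (4 * Me / η ^ 2) ^ 2 + Λ ^ 2) + 7 * absorbC₂ Me Λ k δ η Mg P Q ^ 2)

section Absorb

variable {Me Λ k δ η Mg P Q X A u ηs Ea σ : ℝ} (hMe : 0 ≤ Me) (hΛ : 0 ≤ Λ) (hk : 0 ≤ k)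
    (hδ : 0 < δ) (hη : 0 < η) (hMg : 0 ≤ Mg) (hP : 0 ≤ P) (hQ : 0 ≤ Q)
    (hX : 0 ≤ X) (hX1 : X ≤ 1) (hA : 0 ≤ A) (hA1 : A ≤ 1) (hu : 0 ≤ u) (hu1 : u ≤ 1) (hηs : 0 ≤ ηs) (hηs1 : ηs ≤ 1)
    (hEa : 0 ≤ Ea) (hEa' : Ea ≤ u * (P * ηs + Q * u)) (hσ : σ = 16 * u * Mg / η + Ea)

include hMe hΛ hk hδ hη hP hQ in
/-- `0 ≤ absorbC₂`. [folklore] -/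
theorem absorbC₂_nonneg : 0 ≤ absorbC₂ Me Λ k δ η Mg P Q := by
  unfold absorbC₂; positivity

include hMe hΛ hk hδ hη hP hQ in
/-- `0 ≤ absorbC₁`. [folklore] -/
theorem absorbC₁_nonneg : 0 ≤ absorbC₁ Me Λ k δ η Mg P Q := by
  have := absorbC₂_nonneg hMe hΛ hk hδ hη hP hQ (Mg := Mg)
  unfold absorbC₁; positivity

include hMe hΛ hk hδ hη hP hQ in
/-- `0 ≤ absorbK`. [folklore] -/
theorem absorbK_nonneg : 0 ≤ absorbK Me Λ k δ η Mg P Q := by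
  have := absorbC₂_nonneg hMe hΛ hk hδ hη hP hQ (Mg := Mg)
  have := absorbC₁_nonneg hMe hΛ hk hδ hη hP hQ (Mg := Mg)
  unfold absorbK; positivity

include hδ hEa hσ hMg hη hu in
/-- `0 ≤ bndErr` on nonnegative data. [folklore] -/
theorem bndErr_nonneg' (hk : 0 ≤ k) (hMe : 0 ≤ Me) (hΛ : 0 ≤ Λ) (hX : 0 ≤ X) (hA : 0 ≤ A) :
    0 ≤ bndErr k Me Λ η δ σ Ea X A u := by
  have : 0 ≤ σ := by rw [hσ]; positivity
  unfold bndErr; positivity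

include hMe hΛ hk hδ hη hMg hP hQ hX hX1 hA hA1 hu hu1 hηs hηs1 hEa hEa' hσ in
/-- `B_e ≤ C₂ W`. [folklore] -/
theorem bndErr_le_absorb : bndErr k Me Λ η δ σ Ea X A u ≤ absorbC₂ Me Λ k δ η Mg P Q * absorbW X A u ηs := by
  obtain ⟨m1, m2, m3, m4, m5, m6, m7, -, m9, -⟩ := monomials_le_absorbW hX hX1 hA hA1 hu hu1 hηs hηs1
  set W := absorbW X A u ηs with hW
  have hW0 : 0 ≤ W := absorbW_nonneg hX hA hu hηs
  have hσ0 : 0 ≤ σ := by rw [hσ]; positivity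
  have hσ1 : σ ≤ u * (16 * Mg / η + P + Q) := by
    have h1 : Ea ≤ u * (P + Q) := hEa'.trans (by
      apply mul_le_mul_of_nonneg_left _ hu
      nlinarith [mul_le_of_le_one_right hP hηs1, mul_le_of_le_one_right hQ hu1])
    have e : u * (16 * Mg / η + P + Q) = 16 * u * Mg / η + u * (P + Q) := by ring
    rw [hσ, e]; linarith
  have t1 : 2 * k * (3 * σ ^ 2) / δ ^ 2 ≤ 6 * k * (16 * Mg / η + P + Q) ^ 2 / δ ^ 2 * W := by
    have hσ2 : σ ^ 2 ≤ u ^ 2 * (16 * Mg / η + P + Q) ^ 2 := by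
      calc σ ^ 2 ≤ (u * (16 * Mg / η + P + Q)) ^ 2 := pow_le_pow_left₀ hσ0 hσ1 2
        _ = _ := by ring
    calc 2 * k * (3 * σ ^ 2) / δ ^ 2 = 6 * k / δ ^ 2 * σ ^ 2 := by ring
      _ ≤ 6 * k / δ ^ 2 * (u ^ 2 * (16 * Mg / η + P + Q) ^ 2) := by gcongr
      _ = 6 * k * (16 * Mg / η + P + Q) ^ 2 / δ ^ 2 * u ^ 2 := by ring
      _ ≤ _ := by gcongr
  have t2 : k * Ea / δ ≤ (k * P / δ + k * Q / δ) * W := by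
    calc k * Ea / δ = k / δ * Ea := by ring
      _ ≤ k / δ * (u * (P * ηs + Q * u)) := by gcongr
      _ = k * P / δ * (u * ηs) + k * Q / δ * u ^ 2 := by ring
      _ ≤ k * P / δ * W + k * Q / δ * W := by gcongr
      _ = _ := by ring
  have t3 : u * (16 * Λ / η) * (X + A) ≤ 16 * Λ / η * W := by
    have hle : u * X + u * A ≤ W := by
      have : W - (u * X + u * A) = u * ηs + u ^ 2 + X ^ 3 + A ^ 2 + A * X := by rw [hW, absorbW]; ring
      nlinarith [mul_nonneg hu hηs, pow_nonneg hu 2, pow_nonneg hX 3, pow_nonneg hA 2, mul_nonneg hA hX]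
    calc u * (16 * Λ / η) * (X + A) = 16 * Λ / η * (u * X + u * A) := by ring
      _ ≤ 16 * Λ / η * W := by gcongr
  have t4 : Me * (16 * X ^ 3 / η ^ 3 + 8 * X * A / η ^ 2 + 16 * X ^ 2 * A / η ^ 3 + 8 * A ^ 2 / η ^ 2) ≤
      Me * (32 / η ^ 3 + 16 / η ^ 2) * W := by
    calc Me * (16 * X ^ 3 / η ^ 3 + 8 * X * A / η ^ 2 + 16 * X ^ 2 * A / η ^ 3 + 8 * A ^ 2 / η ^ 2)
        = Me * (16 / η ^ 3 * X ^ 3 + 8 / η ^ 2 * (A * X) + 16 / η ^ 3 * (X ^ 2 * A) + 8 / η ^ 2 * A ^ 2) := by ring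
      _ ≤ Me * (16 / η ^ 3 * W + 8 / η ^ 2 * W + 16 / η ^ 3 * W + 8 / η ^ 2 * W) := by gcongr
      _ = _ := by ring
  calc bndErr k Me Λ η δ σ Ea X A u
      = 2 * k * (3 * σ ^ 2) / δ ^ 2 + k * Ea / δ + u * (16 * Λ / η) * (X + A) +
          Me * (16 * X ^ 3 / η ^ 3 + 8 * X * A / η ^ 2 + 16 * X ^ 2 * A / η ^ 3 + 8 * A ^ 2 / η ^ 2) := by rw [bndErr]
    _ ≤ 6 * k * (16 * Mg / η + P + Q) ^ 2 / δ ^ 2 * W + (k * P / δ + k * Q / δ) * W + 16 * Λ / η * W +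
          Me * (32 / η ^ 3 + 16 / η ^ 2) * W := by linarith
    _ = _ := by rw [absorbC₂]; ring

include hMe hΛ hk hδ hη hMg hP hQ hX hX1 hA hA1 hu hu1 hηs hηs1 hEa hEa' hσ in
/-- `B_L + B_Q + B_e ≤ C₁ (|x| + |a| + u)`. [folklore] -/
theorem bnd_sum_le_absorb :
    bndL Me η X + bndQ Me Λ η X A u + bndErr k Me Λ η δ σ Ea X A u ≤ absorbC₁ Me Λ k δ η Mg P Q * (X + A + u) := by
  obtain ⟨-, -, -, -, -, -, -, -, -, -, -, hW4, -⟩ := monomials_le_absorbW hX hX1 hA hA1 hu hu1 hηs hηs1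
  have hBe := bndErr_le_absorb hMe hΛ hk hδ hη hMg hP hQ hX hX1 hA hA1 hu hu1 hηs hηs1 hEa hEa' hσ
  have hC₂ := absorbC₂_nonneg hMe hΛ hk hδ hη hP hQ (Mg := Mg)
  have hX2 : X ^ 2 ≤ X := by nlinarith
  have e1 : bndL Me η X ≤ 2 * Me / η * (X + A + u) := by
    rw [bndL]; gcongr; linarith
  have e2 : bndQ Me Λ η X A u ≤ (2 * Me / η + 4 * Me / η ^ 2 + Λ) * (X + A + u) := by
    have h1 : 2 * Me / η * A ≤ 2 * Me / η * (X + A + u) := by gcongr; linarith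
    have h2 : 2⁻¹ * (8 * Me / η ^ 2) * X ^ 2 ≤ 4 * Me / η ^ 2 * (X + A + u) := by
      have : 2⁻¹ * (8 * Me / η ^ 2) = 4 * Me / η ^ 2 := by ring
      rw [this]; gcongr; linarith
    have h3 : u * Λ ≤ Λ * (X + A + u) := by nlinarith
    rw [bndQ]; linarith
  have e3 : bndErr k Me Λ η δ σ Ea X A u ≤ 4 * absorbC₂ Me Λ k δ η Mg P Q * (X + A + u) := by
    have := mul_le_mul_of_nonneg_left hW4 hC₂
    linarith
  calc _ ≤ 2 * Me / η * (X + A + u) + (2 * Me / η + 4 * Me / η ^ 2 + Λ) * (X + A + u) +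
        4 * absorbC₂ Me Λ k δ η Mg P Q * (X + A + u) := add_le_add (add_le_add e1 e2) e3
    _ = _ := by rw [absorbC₁]; ring

include hMe hΛ hk hδ hη hMg hP hQ hX hX1 hA hA1 hu hu1 hηs hηs1 hEa hEa' hσ in
/-- **Absorption of the raw error**: `rawErr B_L B_Q B_e ≤ K · W`. [folklore] -/
theorem rawErr_absorb :
    rawErr (bndL Me η X) (bndQ Me Λ η X A u) (bndErr k Me Λ η δ σ Ea X A u) ≤
      absorbK Me Λ k δ η Mg P Q * absorbW X A u ηs := by
  obtain ⟨m1, m2, m3, m4, m5, m6, m7, m8, m9, m10, m11, hW4, hW7, hT3⟩ :=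
    monomials_le_absorbW hX hX1 hA hA1 hu hu1 hηs hηs1
  have hBe := bndErr_le_absorb hMe hΛ hk hδ hη hMg hP hQ hX hX1 hA hA1 hu hu1 hηs hηs1 hEa hEa' hσ
  have hsum := bnd_sum_le_absorb hMe hΛ hk hδ hη hMg hP hQ hX hX1 hA hA1 hu hu1 hηs hηs1 hEa hEa' hσ
  have hC₂ := absorbC₂_nonneg hMe hΛ hk hδ hη hP hQ (Mg := Mg)
  have hC₁ := absorbC₁_nonneg hMe hΛ hk hδ hη hP hQ (Mg := Mg)
  have hBe0 : 0 ≤ bndErr k Me Λ η δ σ Ea X A u := bndErr_nonneg' hδ hη hMg hu hEa hσ hk hMe hΛ hX hA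
  have hW0 : 0 ≤ absorbW X A u ηs := absorbW_nonneg hX hA hu hηs
  set W := absorbW X A u ηs with hW
  set C₂ := absorbC₂ Me Λ k δ η Mg P Q with hC₂d
  set C₁ := absorbC₁ Me Λ k δ η Mg P Q with hC₁d
  set e := bndErr k Me Λ η δ σ Ea X A u with hed
  have hL : bndL Me η X = 2 * Me / η * X := by rw [bndL]
  have hq : bndQ Me Λ η X A u = 2 * Me / η * A + 4 * Me / η ^ 2 * X ^ 2 + Λ * u := by rw [bndQ]; ring
  set L₀ := 2 * Me / η with hL₀
  set Q₀ := 4 * Me / η ^ 2 with hQ₀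
  have hL₀0 : 0 ≤ L₀ := by positivity
  have hQ₀0 : 0 ≤ Q₀ := by positivity
  have hLb0 : 0 ≤ bndL Me η X := by rw [hL]; positivity
  have hq0 : 0 ≤ bndQ Me Λ η X A u := by rw [hq]; positivity
  -- the cube
  have hs0 : 0 ≤ bndL Me η X + bndQ Me Λ η X A u + e := by positivity
  have hcube : (bndL Me η X + bndQ Me Λ η X A u + e) ^ 3 ≤ 9 * C₁ ^ 3 * W := by
    calc _ ≤ (C₁ * (X + A + u)) ^ 3 := pow_le_pow_left₀ hs0 hsum 3
      _ = C₁ ^ 3 * (X + A + u) ^ 3 := by ring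
      _ ≤ C₁ ^ 3 * (9 * W) := by gcongr
      _ = _ := by ring
  -- the cross term
  have c1 : bndL Me η X * bndQ Me Λ η X A u ≤ (L₀ ^ 2 + L₀ * Q₀ + L₀ * Λ) * W := by
    rw [hL, hq]
    calc L₀ * X * (L₀ * A + Q₀ * X ^ 2 + Λ * u) = L₀ ^ 2 * (A * X) + L₀ * Q₀ * X ^ 3 + L₀ * Λ * (u * X) := by ring
      _ ≤ L₀ ^ 2 * W + L₀ * Q₀ * W + L₀ * Λ * W := by gcongr
      _ = _ := by ring
  have c2 : bndL Me η X * e ≤ L₀ * C₂ * W := by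
    rw [hL]
    calc L₀ * X * e ≤ L₀ * 1 * (C₂ * W) := by gcongr
      _ = _ := by ring
  have c3 : (bndQ Me Λ η X A u + e) ^ 2 ≤ 2 * (3 * (L₀ ^ 2 + Q₀ ^ 2 + Λ ^ 2) + 7 * C₂ ^ 2) * W := by
    have hq2 : bndQ Me Λ η X A u ^ 2 ≤ 3 * (L₀ ^ 2 + Q₀ ^ 2 + Λ ^ 2) * W := by
      rw [hq]
      have h2 : (L₀ * A) ^ 2 + (Q₀ * X ^ 2) ^ 2 + (Λ * u) ^ 2 ≤ (L₀ ^ 2 + Q₀ ^ 2 + Λ ^ 2) * W := by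
        calc (L₀ * A) ^ 2 + (Q₀ * X ^ 2) ^ 2 + (Λ * u) ^ 2 = L₀ ^ 2 * A ^ 2 + Q₀ ^ 2 * X ^ 4 + Λ ^ 2 * u ^ 2 := by ring
          _ ≤ L₀ ^ 2 * W + Q₀ ^ 2 * W + Λ ^ 2 * W := by gcongr
          _ = _ := by ring
      calc (L₀ * A + Q₀ * X ^ 2 + Λ * u) ^ 2 ≤ 3 * ((L₀ * A) ^ 2 + (Q₀ * X ^ 2) ^ 2 + (Λ * u) ^ 2) := by
            refine sub_nonneg.1 ?_
            have key : 3 * ((L₀ * A) ^ 2 + (Q₀ * X ^ 2) ^ 2 + (Λ * u) ^ 2) - (L₀ * A + Q₀ * X ^ 2 + Λ * u) ^ 2 =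
                (L₀ * A - Q₀ * X ^ 2) ^ 2 + (L₀ * A - Λ * u) ^ 2 + (Q₀ * X ^ 2 - Λ * u) ^ 2 := by ring
            rw [key]; positivity
        _ ≤ 3 * ((L₀ ^ 2 + Q₀ ^ 2 + Λ ^ 2) * W) := by gcongr
        _ = _ := by ring
    have he2 : e ^ 2 ≤ 7 * C₂ ^ 2 * W := by
      calc e ^ 2 ≤ (C₂ * W) ^ 2 := pow_le_pow_left₀ hBe0 hBe 2
        _ = C₂ ^ 2 * W * W := by ring
        _ ≤ C₂ ^ 2 * W * 7 := by gcongr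
        _ = _ := by ring
    calc (bndQ Me Λ η X A u + e) ^ 2 ≤ 2 * bndQ Me Λ η X A u ^ 2 + 2 * e ^ 2 := by
          refine sub_nonneg.1 ?_
          have key : 2 * bndQ Me Λ η X A u ^ 2 + 2 * e ^ 2 - (bndQ Me Λ η X A u + e) ^ 2 = (bndQ Me Λ η X A u - e) ^ 2 := by ring
          rw [key]; positivity
      _ ≤ 2 * (3 * (L₀ ^ 2 + Q₀ ^ 2 + Λ ^ 2) * W) + 2 * (7 * C₂ ^ 2 * W) := by gcongr
      _ = _ := by ring
  have hcross : 2⁻¹ * ((bndQ Me Λ η X A u + e) * (2 * bndL Me η X + (bndQ Me Λ η X A u + e))) ≤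
      (L₀ ^ 2 + L₀ * Q₀ + L₀ * Λ + L₀ * C₂ + 3 * (L₀ ^ 2 + Q₀ ^ 2 + Λ ^ 2) + 7 * C₂ ^ 2) * W := by
    have hid : 2⁻¹ * ((bndQ Me Λ η X A u + e) * (2 * bndL Me η X + (bndQ Me Λ η X A u + e))) =
        bndL Me η X * bndQ Me Λ η X A u + bndL Me η X * e + 2⁻¹ * (bndQ Me Λ η X A u + e) ^ 2 := by ring
    have c3' : 2⁻¹ * (bndQ Me Λ η X A u + e) ^ 2 ≤ (3 * (L₀ ^ 2 + Q₀ ^ 2 + Λ ^ 2) + 7 * C₂ ^ 2) * W := by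
      have h2 : (0 : ℝ) < 2 := by norm_num
      rw [inv_mul_le_iff₀ h2, ← mul_assoc]; exact c3
    rw [hid]
    calc _ ≤ (L₀ ^ 2 + L₀ * Q₀ + L₀ * Λ) * W + L₀ * C₂ * W + (3 * (L₀ ^ 2 + Q₀ ^ 2 + Λ ^ 2) + 7 * C₂ ^ 2) * W :=
          add_le_add (add_le_add c1 c2) c3'
      _ = _ := by ring
  -- assemble
  calc rawErr (bndL Me η X) (bndQ Me Λ η X A u) e
      = (bndL Me η X + bndQ Me Λ η X A u + e) ^ 3 + e +
          2⁻¹ * ((bndQ Me Λ η X A u + e) * (2 * bndL Me η X + (bndQ Me Λ η X A u + e))) := by rw [rawErr]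
    _ ≤ 9 * C₁ ^ 3 * W + C₂ * W +
          (L₀ ^ 2 + L₀ * Q₀ + L₀ * Λ + L₀ * C₂ + 3 * (L₀ ^ 2 + Q₀ ^ 2 + Λ ^ 2) + 7 * C₂ ^ 2) * W :=
        add_le_add (add_le_add hcube hBe) hcross
    _ = absorbK Me Λ k δ η Mg P Q * W := by rw [absorbK, hC₁d, hC₂d, hL₀, hQ₀]; ring

end Absorb

/-! ### `exp (ell E_B ρ 0 o) = oneSidedM ρ B o` for a `+`-hull -/

variable {B : Set ℂ}

/-- For a `+`-hull and `o < 0`, `E_B(o) < 0` (`E_B` is increasing on `(−∞, 0]` with `E_B(0) = 0`: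
`−E_B(o) = ∫_o^0 Φ'_{B−y}(0) dy > 0`). [cite: LawlerSchrammWerner2003Restriction, §8.4 (h_t(O_t) < h_t(W_t))] -/
theorem _root_.Literature.Probability.RandomPlanarGeometry.IsPlusHull.re_starMap_neg (hB : IsPlusHull B) {o : ℝ} (ho : o < 0) : (starMap B o).re < 0 := by
  have hoff : ∀ y ∈ Icc o 0, ((y : ℝ) : ℂ) ∉ B := fun y hy ↦ hB.ofReal_notMem_of_nonpos hy.2
  have hint := integral_hullDeriv_translate hB.1 ho hoff
  have hcont : ContinuousOn (fun y : ℝ ↦ hullDeriv (translate B y)) (Icc o 0) := by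
    have h1 : ContinuousOn (fun y : ℝ ↦ (deriv (starMap B) y).re) (Icc o 0) :=
      (continuousOn_re_deriv_starMap hB.1).mono fun y hy ↦ hoff y hy
    exact h1.congr fun y hy ↦ hullDeriv_translate hB.1 (hoff y hy)
  have hpos : 0 < ∫ y in o..(0 : ℝ), hullDeriv (translate B y) :=
    intervalIntegral.intervalIntegral_pos_of_pos_on (hcont.intervalIntegrable_of_Icc ho.le)
      (fun y _ ↦ hullDeriv_pos _) ho
  linarith

/-- **`exp (ell E_B ρ 0 o) = M`** for a `+`-hull `B` and `o ≤ 0`: the three logarithms are those of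
the positive reals `Φ'_B(0)`, `E_B'(o) = Φ'_{B−o}(0)` and `DQ E_B 0 o = E_B(o)/o = hullSlope B o`, so
`exp ell = Φ'_B(0)^{5/8} E_B'(o)^b (E_B(o)/o)^c = oneSidedM ρ B o` (`IsPlusHull.oneSidedM_eq_starMap`);
at `o = 0` all three arguments are `Φ'_B(0)` and `exp ell = Φ'_B(0)^{5/8+b+c} = Φ'_B(0)^α`
(`oneSidedM_zero`: "when `W_t = O_t` we take `M_t = h_t'(W_t)^{5/8+b+c}`").
[cite: LawlerSchrammWerner2003Restriction, §8.4 (definition of M_t)] -/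
theorem _root_.Literature.Probability.RandomPlanarGeometry.IsPlusHull.exp_ell_zero_eq (hB : IsPlusHull B) (ρ : ℝ) {o : ℝ} (ho : o ≤ 0) :
    Complex.exp (ell (starMap B) ρ 0 o) = ((oneSidedM ρ B o : ℝ) : ℂ) := by
  obtain ⟨hd0, -, -⟩ := starDeriv_spec hB.1
  have hE0 : deriv (starMap B) 0 = ((starDeriv B : ℝ) : ℂ) := deriv_starMap_zero hB.1
  have h58 : (5 / 8 : ℂ) = ((5 / 8 : ℝ) : ℂ) := by push_cast; ring
  rcases ho.lt_or_eq with ho | rfl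
  · have hoB := hB.ofReal_notMem_of_nonpos ho.le
    have him := im_deriv_starMap_ofReal hB.1 hoB
    obtain ⟨hepos, -⟩ := re_deriv_starMap_pos_le_one hB.1 hoB
    have he : deriv (starMap B) o = (((deriv (starMap B) o).re : ℝ) : ℂ) :=
      Complex.ext (by simp) (by simp [him])
    have hEo := starMap_ofReal_eq_re' hB.1 hoB
    have ho0 : (0 : ℂ) ≠ (o : ℂ) := fun h ↦ ho.ne (by exact_mod_cast h.symm)
    have hq : DQ (starMap B) 0 o = ((((starMap B o).re / o : ℝ)) : ℂ) := by
      rw [DQ_of_ne _ ho0, starMap_zero hB.1, zero_sub, zero_sub, neg_div_neg_eq, Complex.ofReal_div]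
      exact congrArg (· / (o : ℂ)) hEo
    have hqpos : 0 < (starMap B o).re / o := div_pos_of_neg_of_neg (hB.re_starMap_neg ho) ho
    rw [ell, hE0, hq, h58]
    conv_lhs => rw [he]
    rw [Complex.exp_add, Complex.exp_add, exp_mul_log_ofReal hd0, exp_mul_log_ofReal hepos, exp_mul_log_ofReal hqpos,
      hB.oneSidedM_eq_starMap ho ρ]
    push_cast; ring
  · simp only [Complex.ofReal_zero]
    rw [oneSidedM_zero, hullDeriv_eq_starDeriv, ell, DQ_same, hE0]
    have : (5 / 8 : ℂ) * Complex.log ((starDeriv B : ℝ) : ℂ) + (expB ρ : ℂ) * Complex.log ((starDeriv B : ℝ) : ℂ) +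
        (expC ρ : ℂ) * Complex.log ((starDeriv B : ℝ) : ℂ) =
        ((5 / 8 + expB ρ + expC ρ : ℝ) : ℂ) * Complex.log ((starDeriv B : ℝ) : ℂ) := by push_cast; ring
    rw [this, exp_mul_log_ofReal hd0, five_eighths_add_expB_add_expC]

/-! ### The jets on the diagonal `o = 0` and `(ρ ∂ₓ − 2 ∂_y) ell (0, 0) = 0` -/

variable {E : ℂ → ℂ} {δ η R : ℝ}

/-- `∂ₓ ell(x, 0)` at `x = 0`: `(5/8) E''(0)/E'(0) + c F'(0)/F(0)` with `F = DQ E · 0`, `F(0) = E'(0)`,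
`F'(0) = E''(0)/2`. [cite: LawlerSchrammWerner2003Restriction, §8.4 (M_t at W_t = O_t)] -/
theorem hasDerivAt_ell_left_diag (hc : JetControl E δ η R) (ρ : ℝ) :
    HasDerivAt (fun x ↦ ell E ρ x 0)
      ((5 / 8 : ℂ) * (deriv (deriv E) 0 / deriv E 0) + (expC ρ : ℂ) * (deriv (deriv E) 0 / 2 / deriv E 0)) 0 := by
  have h1 : HasDerivAt (fun x ↦ Complex.log (deriv E x)) (deriv (deriv E) 0 / deriv E 0) 0 :=
    (hc.hasDerivAt_deriv hc.zero_mem).clog (hc.deriv_mem_slitPlane hc.zero_mem)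
  have hF : HasDerivAt (fun y ↦ DQ E y 0) (deriv (deriv E) 0 / 2) 0 := by
    rw [← deriv_DQ_zero_zero hc]
    exact ((differentiableOn_DQ_zero hc).differentiableAt ((isOpen_jetBox R η).mem_nhds hc.zero_mem)).hasDerivAt
  have h3 : HasDerivAt (fun x ↦ Complex.log (DQ E x 0)) (deriv (deriv E) 0 / 2 / DQ E 0 0) 0 :=
    hF.clog (DQ_mem_slitPlane hc hc.zero_mem hc.zero_mem)
  rw [DQ_zero_zero] at h3
  have h := ((h1.const_mul (5 / 8 : ℂ)).add (hasDerivAt_const (0 : ℂ) ((expB ρ : ℂ) * Complex.log (deriv E 0)))).add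
    (h3.const_mul (expC ρ : ℂ))
  simp only [add_zero] at h
  exact h

/-- `∂_y ell(0, y)` at `y = 0`: `b E''(0)/E'(0) + c F'(0)/F(0)` (`DQ E 0 y = F(y)` by symmetry).
[cite: LawlerSchrammWerner2003Restriction, §8.4 (M_t at W_t = O_t)] -/
theorem hasDerivAt_ell_right_diag (hc : JetControl E δ η R) (ρ : ℝ) :
    HasDerivAt (fun y ↦ ell E ρ 0 y)
      ((expB ρ : ℂ) * (deriv (deriv E) 0 / deriv E 0) + (expC ρ : ℂ) * (deriv (deriv E) 0 / 2 / deriv E 0)) 0 := by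
  have h2 : HasDerivAt (fun y ↦ Complex.log (deriv E y)) (deriv (deriv E) 0 / deriv E 0) 0 :=
    (hc.hasDerivAt_deriv hc.zero_mem).clog (hc.deriv_mem_slitPlane hc.zero_mem)
  have hF : HasDerivAt (fun y ↦ DQ E 0 y) (deriv (deriv E) 0 / 2) 0 := by
    have hfun : (fun y ↦ DQ E 0 y) = fun y ↦ DQ E y 0 := funext fun y ↦ DQ_comm E 0 y
    rw [hfun, ← deriv_DQ_zero_zero hc]
    exact ((differentiableOn_DQ_zero hc).differentiableAt ((isOpen_jetBox R η).mem_nhds hc.zero_mem)).hasDerivAt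
  have h3 : HasDerivAt (fun y ↦ Complex.log (DQ E 0 y)) (deriv (deriv E) 0 / 2 / DQ E 0 0) 0 :=
    hF.clog (DQ_mem_slitPlane hc hc.zero_mem hc.zero_mem)
  rw [DQ_zero_zero] at h3
  have h := ((hasDerivAt_const (0 : ℂ) ((5 / 8 : ℂ) * Complex.log (deriv E 0))).add (h2.const_mul (expB ρ : ℂ))).add
    (h3.const_mul (expC ρ : ℂ))
  simp only [zero_add] at h
  exact h

/-- **`(ρ ∂ₓ − 2 ∂_y) ell (0, 0) = 0`**: on the diagonal the coefficient of `J dt` in the drift of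
`log M` vanishes (the same cancellation `5ρ/8 + ρc/2 − 2b − c = 0` as `phiFun_zero`; this is what
makes [LSW]'s `M_t` a continuous semimartingale across `W_t = O_t`).
[cite: LawlerSchrammWerner2003Restriction, §8.4 (M_t at W_t = O_t) with the proof of Lemma 8.9] -/
theorem rho_deriv_ell_sub_two_deriv_ell_diag (hc : JetControl E δ η R) (ρ : ℝ) :
    (ρ : ℂ) * deriv (fun x ↦ ell E ρ x 0) 0 - 2 * deriv (fun y ↦ ell E ρ 0 y) 0 = 0 := by
  rw [(hasDerivAt_ell_left_diag hc ρ).deriv, (hasDerivAt_ell_right_diag hc ρ).deriv]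
  have hd : deriv E 0 ≠ 0 := hc.deriv_ne_zero hc.zero_mem
  simp only [expB, expC]
  push_cast
  field_simp
  ring

/-! ### The companion facts on the jets at a controlled state -/

section JetFacts

variable {ρ₀ : ℝ} (hB : IsStarHull B) (hρ₀ : 0 < ρ₀) (hBρ : Disjoint (ball (0 : ℂ) (8 * ρ₀)) B)
  (hJ : JetControl (starMap B) δ η R)

include hJ in
/-- **Bounds on the jets**: `|ℓ₁|, |m₁| ≤ 2M_ℓ/η`, `|ℓ₂| ≤ 8M_ℓ/η²` at every real `o ∈ [−R−2, η]`.
[folklore] -/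
theorem norm_jets_le (ρ : ℝ) {o : ℝ} (ho : o ∈ Icc (-R - 2) η) :
    ‖deriv (fun x ↦ ell (starMap B) ρ x o) 0‖ ≤ 2 * ellBound ρ δ / η ∧
      ‖deriv (fun y ↦ ell (starMap B) ρ 0 y) o‖ ≤ 2 * ellBound ρ δ / η ∧
      ‖iteratedDeriv 2 (fun x ↦ ell (starMap B) ρ x o) 0‖ ≤ 8 * ellBound ρ δ / η ^ 2 := by
  obtain ⟨h1, h2, h3⟩ := norm_coeff_le hJ ρ ho
  exact ⟨h1, h3, h2⟩

include hB hρ₀ hBρ hJ in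
/-- **`|λ| ≤ Λ`** at every real `o ∈ [−R−2, η/2]`. [folklore] -/
theorem norm_lam_zero_le (ρ : ℝ) {o : ℝ} (ho : o ∈ Icc (-R - 2) (η / 2)) :
    ‖lam (starMap B) (glueDrift B ρ₀) ρ 0 o‖ ≤ lamBound ρ δ η (glueDriftBound ρ₀ δ) := by
  have hη := hJ.η_pos
  have hη1 := hJ.η_le_one
  exact norm_lam_le hJ (driftData_glueDrift hB hρ₀ hBρ hJ) ρ
    (ball_zero_subset_innerBox hJ.R_nonneg hη1 (mem_ball_self (by positivity)))
    (ball_subset_innerBox hη1 ho (mem_ball_self (by positivity)))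

include hB hρ₀ hBρ hJ in
/-- **[LSW] Lemma 8.9, the drift identity at a controlled state, multiplied by `Z = −o ≥ 0`**:
`ρℓ₁ − 2m₁ + Z (λ + (4/3)(ℓ₂ + ℓ₁²)) = 0` for every real `o ∈ [−R−2, 0]` — for `o < 0` this is
`jetDrift_eq_zero` in the closed forms of the jets, at `o = 0` it is `(ρ∂ₓ − 2∂_y) ell(0,0) = 0`.
[cite: LawlerSchrammWerner2003Restriction, Lemma 8.9 and its proof] -/
theorem drift_identity (ρ : ℝ) {o : ℝ} (ho : o ∈ Icc (-R - 2) 0) :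
    (ρ : ℂ) * deriv (fun x ↦ ell (starMap B) ρ x o) 0 - 2 * deriv (fun y ↦ ell (starMap B) ρ 0 y) o +
      ((-o : ℝ) : ℂ) * (lam (starMap B) (glueDrift B ρ₀) ρ 0 o +
        4 / 3 * (iteratedDeriv 2 (fun x ↦ ell (starMap B) ρ x o) 0 + deriv (fun x ↦ ell (starMap B) ρ x o) 0 ^ 2)) = 0 := by
  rcases ho.2.lt_or_eq with ho0 | rfl
  · have hoJ : (o : ℂ) ∈ jetBox R η := ofReal_mem_jetBox hJ ⟨ho.1, ho.2.trans hJ.η_pos.le⟩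
    have ho0' : (o : ℂ) ≠ 0 := by exact_mod_cast ho0.ne
    have hd : deriv (starMap B) 0 ≠ 0 := hJ.deriv_ne_zero hJ.zero_mem
    have he₀ : starMap B o ≠ 0 := hJ.map_ne_zero hoJ ho0'
    have he₁ : deriv (starMap B) o ≠ 0 := hJ.deriv_ne_zero hoJ
    have key := jetDrift_eq_zero_complex ρ ho0' he₀ he₁ hd (deriv (deriv (starMap B)) o)
      (deriv (deriv (starMap B)) 0) (deriv (deriv (deriv (starMap B))) 0)
    rw [deriv_ell_left_eq hJ ρ hoJ ho0', deriv_ell_right_eq hJ ρ hoJ ho0', iteratedDeriv_two_ell_left_eq hJ ρ hoJ ho0',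
      lam_glueDrift_zero_eq_jetLam hB hρ₀ hBρ hJ ρ hoJ ho0']
    have hL1 : (5 / 8 : ℂ) * (deriv (deriv (starMap B)) 0 / deriv (starMap B) 0) +
        (expC ρ : ℂ) * (1 / (o : ℂ) - deriv (starMap B) 0 / starMap B o) =
        jetL1 (expC ρ : ℂ) o (starMap B o) (deriv (starMap B) 0) (deriv (deriv (starMap B)) 0) := rfl
    have hM1 : (expB ρ : ℂ) * (deriv (deriv (starMap B)) o / deriv (starMap B) o) +
        (expC ρ : ℂ) * (deriv (starMap B) o / starMap B o - 1 / (o : ℂ)) =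
        jetM1 (expB ρ : ℂ) (expC ρ : ℂ) o (starMap B o) (deriv (starMap B) o) (deriv (deriv (starMap B)) o) := rfl
    have hL2 : (5 / 8 : ℂ) * ((deriv (deriv (deriv (starMap B))) 0 * deriv (starMap B) 0 -
          deriv (deriv (starMap B)) 0 * deriv (deriv (starMap B)) 0) / deriv (starMap B) 0 ^ 2) +
        (expC ρ : ℂ) * (((-((o : ℂ) * deriv (deriv (starMap B)) 0)) * ((o : ℂ) * starMap B o) -
          (starMap B o - (o : ℂ) * deriv (starMap B) 0) * (-(starMap B o + (o : ℂ) * deriv (starMap B) 0))) /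
          ((o : ℂ) * starMap B o) ^ 2) =
        jetL2 (expC ρ : ℂ) o (starMap B o) (deriv (starMap B) 0) (deriv (deriv (starMap B)) 0)
          (deriv (deriv (deriv (starMap B))) 0) := by
      simp only [jetL2]; ring
    rw [hL1, hM1, hL2]
    set L1 := jetL1 (expC ρ : ℂ) o (starMap B o) (deriv (starMap B) 0) (deriv (deriv (starMap B)) 0)
    set M1 := jetM1 (expB ρ : ℂ) (expC ρ : ℂ) o (starMap B o) (deriv (starMap B) o) (deriv (deriv (starMap B)) o)
    set L2 := jetL2 (expC ρ : ℂ) o (starMap B o) (deriv (starMap B) 0) (deriv (deriv (starMap B)) 0)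
      (deriv (deriv (deriv (starMap B))) 0)
    set Lam := jetLam (expB ρ : ℂ) (expC ρ : ℂ) o (starMap B o) (deriv (starMap B) o) (deriv (deriv (starMap B)) o)
      (deriv (starMap B) 0) (deriv (deriv (starMap B)) 0) (deriv (deriv (deriv (starMap B))) 0)
    -- `key`: ρ L1/(−o) − 2 M1/(−o) + Lam + 4/3 (L2 + L1²) = 0; multiply by `−o`
    have hmul := congrArg (fun w ↦ (-(o : ℂ)) * w) key
    simp only [mul_zero] at hmul
    have hno : (-(o : ℂ)) ≠ 0 := neg_ne_zero.2 ho0'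
    rw [show (((-o : ℝ)) : ℂ) = -(o : ℂ) by push_cast; ring]
    calc _ = (-(o : ℂ)) * ((ρ : ℂ) * L1 / (-(o : ℂ)) - 2 * M1 / (-(o : ℂ)) + Lam + 4 / 3 * (L2 + L1 ^ 2)) := by
          field_simp; ring
      _ = 0 := hmul
  · simp only [Complex.ofReal_zero, neg_zero, zero_mul, add_zero]
    exact rho_deriv_ell_sub_two_deriv_ell_diag hJ ρ

include hJ in
/-- **`P = O(Z)`**: `|ρℓ₁ − 2m₁| ≤ phiConst · |o|` for every real `o ∈ [−R−2, 0]` (including the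
diagonal, where both sides vanish). [cite: LawlerSchrammWerner2003Restriction, §8.4 (M_t at W_t = O_t)] -/
theorem norm_rho_deriv_sub_two_deriv_le' (ρ : ℝ) {o : ℝ} (ho : o ∈ Icc (-R - 2) 0) :
    ‖(ρ : ℂ) * deriv (fun x ↦ ell (starMap B) ρ x o) 0 - 2 * deriv (fun y ↦ ell (starMap B) ρ 0 y) o‖ ≤
      phiConst ρ δ η * |o| := by
  rcases ho.2.lt_or_eq with ho0 | rfl
  · exact norm_rho_deriv_sub_two_deriv_le hJ ρ ⟨ho.1, ho0⟩
  · simp only [Complex.ofReal_zero, abs_zero, mul_zero]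
    rw [rho_deriv_ell_sub_two_deriv_ell_diag hJ ρ, norm_zero]

end JetFacts

/-! ### The packaged one step for `M = oneSidedM` -/

/-- **The one-step constant** of the controlled class: `exp(M_ℓ) · K_abs`. [folklore] -/
def oneStepK (ρ δ η ρ₀ dmin : ℝ) : ℝ :=
  Real.exp (ellBound ρ δ) * absorbK (ellBound ρ δ) (lamBound ρ δ η (glueDriftBound ρ₀ δ)) (kbc ρ) δ η
    (glueDriftBound ρ₀ δ) (errP dmin δ η ρ₀) (errQ dmin δ η ρ₀)

section Package

variable {ρ₀ dmin : ℝ} {U : ℝ≥0 → ℝ} {u : ℝ≥0} {S : ℝ}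
  (hB : IsPlusHull B) (hρ₀ : 0 < ρ₀) (hBρ : Disjoint (ball (0 : ℂ) (8 * ρ₀)) B)
  (hJ : JetControl (starMap B) δ η R)
  (hU : Continuous U) (hU0 : U 0 = 0) (hu : 0 < u) (hS : ∀ v : ℝ≥0, v ≤ u → |U v| ≤ S)
  (hdmin : 0 < dmin) (hdminB : dmin ≤ starDeriv B)
  (hηs : stepSize S u ≤ dmin * ρ₀ / 1000) (hm : 8 * stepSize S u ≤ δ * ρ₀ / 16) (hηsη : stepSize S u < η / 8)
  (hu1 : (u : ℝ) ≤ 1)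
  (hclear : ∀ t : ℝ, t ∈ Icc (-R - 2) 0 → ρ₀ / 8 ≤ |t| → Disjoint (ball (t : ℂ) ρ₀) B)

include hB hρ₀ hBρ hJ hU hU0 hu hS hdmin hdminB hηs hm hηsη hu1 hclear in
/-- **[LSW] Lemma 8.9, the one step of `M` in deterministic form.** For a `+`-hull `B` in the
controlled class, a driver increment `U` on `[0, u]` with oscillation `S` (`x = U_u`), a displacement
`a ≤ 0` of the force point (`o ↦ o + a`, new relative position `o' = o + a − x ≤ 0`) and the
slid hull `B' = B` slid along `U`:

  `|M(B', o') − M(B, o) − M(B, o)·(ℓ₁x + m₁a + ½(ℓ₂ + ℓ₁²)x² + uλ)| ≤ K · (uη_s + u² + |x|³ + a² + |a||x| + u|a| + u|x|)`,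

`M = oneSidedM ρ`, with the complex jets `ℓ₁, m₁, ℓ₂` of `ell E_B ρ` at `(0, o)` and `λ = lam E_B D ρ 0 o`
(`drift_identity`, `norm_jets_le`, `norm_lam_zero_le`, `norm_rho_deriv_sub_two_deriv_le'`), under the
smallness conditions `hsm₁`, `hsm₂` (linear in `u`, `η_s`, `|a|`).
[cite: LawlerSchrammWerner2003Restriction, Lemma 8.9 and its proof (§8.4)] -/
theorem oneSidedM_slidHull_expansion (ρ : ℝ) {o a : ℝ} (ho : o ∈ Icc (-R) 0) (ha0 : a ≤ 0) (haη : |a| < η / 8)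
    (ho' : o + a - U u ≤ 0)
    (hsm₁ : 16 * u * glueDriftBound ρ₀ δ / η + u * (errP dmin δ η ρ₀ * stepSize S u + errQ dmin δ η ρ₀ * u) ≤ δ / 2)
    (hsm₂ : absorbC₁ (ellBound ρ δ) (lamBound ρ δ η (glueDriftBound ρ₀ δ)) (kbc ρ) δ η (glueDriftBound ρ₀ δ)
        (errP dmin δ η ρ₀) (errQ dmin δ η ρ₀) * (stepSize S u + |a| + u) ≤ 1) :
    ‖((oneSidedM ρ (slidHull U B u) (o + a - U u) : ℝ) : ℂ) - oneSidedM ρ B o -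
        oneSidedM ρ B o *
          (deriv (fun x ↦ ell (starMap B) ρ x o) 0 * (U u : ℝ) + deriv (fun y ↦ ell (starMap B) ρ 0 y) o * a +
            2⁻¹ * (iteratedDeriv 2 (fun x ↦ ell (starMap B) ρ x o) 0 + deriv (fun x ↦ ell (starMap B) ρ x o) 0 ^ 2) *
              (U u : ℝ) ^ 2 +
            (u : ℂ) * lam (starMap B) (glueDrift B ρ₀) ρ 0 o)‖ ≤
      oneStepK ρ δ η ρ₀ dmin * absorbW |U u| |a| u (stepSize S u) := by
  obtain ⟨hd0, hd1, -⟩ := starDeriv_spec hB.1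
  have hη := hJ.η_pos
  have hη1 := hJ.η_le_one
  have hδ := hJ.δ_pos
  have hR := hJ.R_nonneg
  have hηs' : stepSize S u ≤ starDeriv B * ρ₀ / 1000 := hηs.trans (by gcongr)
  obtain ⟨hUu, hη1', hη0⟩ := abs_driver_le hB.1 hu hS hρ₀ hηs'
  have hu0 : (0 : ℝ) ≤ u := u.2
  have hηs1 : stepSize S u ≤ 1 := by nlinarith [hd1]
  -- the error of the jets with `d ∈ [d_min, 1]`
  have hEa := stepErrAll_le hdmin hdminB hd1 hδ hη hρ₀ hη0.le hu0 (ηs := stepSize S u)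
  have hEa0 : 0 ≤ stepErrAll (starDeriv B) δ η ρ₀ (stepSize S u) u := by
    obtain ⟨h1, h2, h3⟩ := stepErr_pieces_nonneg (S := S) (u := u) (η := η) (δ := δ) hd0 hδ hη hρ₀ hη0.le
    have := farRadius_pos hρ₀ hη
    unfold stepErrAll; positivity
  have hMg0 : 0 ≤ glueDriftBound ρ₀ δ := (driftData_glueDrift hB.1 hρ₀ hBρ hJ).M_nonneg
  have hP := errP_nonneg hdmin hδ hη hρ₀
  have hQ := errQ_nonneg hdmin hδ hη hρ₀
  have hMe := (ellBound_pos ρ δ).le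
  have hΛ := lamBound_nonneg ρ hδ hη hMg0
  have hk := (kbc_pos ρ).le
  -- the smallness hypotheses of the raw expansion
  have hsm₁' : 16 * u * glueDriftBound ρ₀ δ / η + stepErrAll (starDeriv B) δ η ρ₀ (stepSize S u) u ≤ δ / 2 := by
    linarith
  have hsum := bnd_sum_le_absorb hMe hΛ hk hδ hη hMg0 hP hQ (abs_nonneg (U u)) (hUu.trans hηs1) (abs_nonneg a)
    (by linarith) hu0 hu1 hη0.le hηs1 hEa0 hEa rfl
  have hC₁ := absorbC₁_nonneg hMe hΛ hk hδ hη hP hQ (Mg := glueDriftBound ρ₀ δ)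
  have hsm₂' := hsum.trans ((mul_le_mul_of_nonneg_left (by linarith : |U u| + |a| + u ≤ stepSize S u + |a| + u) hC₁).trans hsm₂)
  -- the raw expansion and the absorption
  have hraw := norm_exp_oneStep_sub_le hB.1 hρ₀ hBρ hJ hU hU0 hu hS hηs' hm hηsη hclear ρ ho ha0 haη hsm₁' hsm₂'
  have habs := rawErr_absorb hMe hΛ hk hδ hη hMg0 hP hQ (abs_nonneg (U u)) (hUu.trans hηs1) (abs_nonneg a)
    (by linarith) hu0 hu1 hη0.le hηs1 hEa0 hEa rfl
  have hR' := hraw.trans habs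
  -- the two values of `exp ell` are the two values of `M`
  obtain ⟨hρ₀', hB'⟩ := isStarHull_slidHull_canonical hB.1 hU hU0 hS hρ₀ hBρ hηs'
  have hplus' : IsPlusHull (slidHull U B u) :=
    isPlusHull_slidHull_of_disjoint hU hU0 hB (Loewner.disjoint_closedHull hU hU0 hS hρ₀ hBρ hρ₀')
  have hexp1 : Complex.exp (ell (starMap (slidHull U B u)) ρ 0 (((o + a : ℝ) : ℂ) - (U u : ℝ))) =
      ((oneSidedM ρ (slidHull U B u) (o + a - U u) : ℝ) : ℂ) := by
    rw [show (((o + a : ℝ) : ℂ) - (U u : ℝ)) = ((o + a - U u : ℝ) : ℂ) by push_cast; ring]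
    exact hplus'.exp_ell_zero_eq ρ ho'
  have hexp0 : Complex.exp (ell (starMap B) ρ 0 o) = ((oneSidedM ρ B o : ℝ) : ℂ) := hB.exp_ell_zero_eq ρ ho.2
  -- `|exp ell₀| ≤ exp M_ℓ`
  have hoJ : (o : ℂ) ∈ jetBox R η := ofReal_mem_jetBox hJ ⟨by linarith [ho.1], ho.2.trans hη.le⟩
  have hG : ‖Complex.exp (ell (starMap B) ρ 0 o)‖ ≤ Real.exp (ellBound ρ δ) := by
    rw [Complex.norm_exp]
    exact Real.exp_le_exp.2 ((Complex.re_le_norm _).trans (norm_ell_le hJ ρ hJ.zero_mem hoJ))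
  -- assemble: `exp ell₁ − exp ell₀ − exp ell₀ · model = exp ell₀ · (exp(ell₁ − ell₀) − 1 − model)`
  set model := deriv (fun x ↦ ell (starMap B) ρ x o) 0 * ((U u : ℝ) : ℂ) + deriv (fun y ↦ ell (starMap B) ρ 0 y) o * (a : ℂ) +
      2⁻¹ * iteratedDeriv 2 (fun x ↦ ell (starMap B) ρ x o) 0 * ((U u : ℝ) : ℂ) ^ 2 +
      (u : ℂ) * lam (starMap B) (glueDrift B ρ₀) ρ 0 o +
      2⁻¹ * (deriv (fun x ↦ ell (starMap B) ρ x o) 0 * ((U u : ℝ) : ℂ)) ^ 2 with hmodel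
  have hshape : deriv (fun x ↦ ell (starMap B) ρ x o) 0 * ((U u : ℝ) : ℂ) + deriv (fun y ↦ ell (starMap B) ρ 0 y) o * (a : ℂ) +
      2⁻¹ * (iteratedDeriv 2 (fun x ↦ ell (starMap B) ρ x o) 0 + deriv (fun x ↦ ell (starMap B) ρ x o) 0 ^ 2) *
        ((U u : ℝ) : ℂ) ^ 2 +
      (u : ℂ) * lam (starMap B) (glueDrift B ρ₀) ρ 0 o = model := by rw [hmodel]; ring
  rw [hshape, ← hexp1, ← hexp0]
  have hfactor : Complex.exp (ell (starMap (slidHull U B u)) ρ 0 (((o + a : ℝ) : ℂ) - (U u : ℝ))) -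
      Complex.exp (ell (starMap B) ρ 0 o) - Complex.exp (ell (starMap B) ρ 0 o) * model =
      Complex.exp (ell (starMap B) ρ 0 o) *
        (Complex.exp (ell (starMap (slidHull U B u)) ρ 0 (((o + a : ℝ) : ℂ) - (U u : ℝ)) - ell (starMap B) ρ 0 o) - 1 -
          model) := by
    rw [Complex.exp_sub]
    have hne : Complex.exp (ell (starMap B) ρ 0 o) ≠ 0 := Complex.exp_ne_zero _
    field_simp
  rw [hfactor, norm_mul, oneStepK, mul_assoc]
  have hK0 := absorbK_nonneg hMe hΛ hk hδ hη hP hQ (Mg := glueDriftBound ρ₀ δ)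
  have hW0 := absorbW_nonneg (abs_nonneg (U u)) (abs_nonneg a) hu0 hη0.le (ηs := stepSize S u)
  exact mul_le_mul hG hR' (norm_nonneg _) (Real.exp_pos _).le

end Package

end SLEKappaRho

end Literature.Probability.RandomPlanarGeometry

end
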